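import Literature.GroupTheory.Coxeter.ParabolicSubsystems
import HarnessLib

/-!
# Subsets of the canonical generators are canonical: `χ(⟨X′⟩) = X′` for `X′ ⊆ χ(W′)` (Dyer 1990 Proposition 3.5, necessity; Remark 2.11, (3.1))

Layer `Literature/GroupTheory/Coxeter`, namespace `Literature.GroupTheory.Coxeter`; lane `lit-hodgefound` (Track 2 foundations library; prover seat p13,
generation 30, fifteenth file — over `ReflectionSubgroups` (Dyer's `χ(G₁) = canonicalGenerators s N G₁`, the Coxeter ∕ reflection system `(G₁, χ(G₁))`:
`inclusion s N G₁`, `restrict N G₁`, `isPreCoxeterSystem_inclusion`, `isReflectionCocycle_restrict`, `mem_reflections_inclusion_iff`) and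
`ParabolicSubsystems` (★ `IsReflectionCocycle.canonicalGenerators_closure_eq` : `χ(W_I) = s(I)` for a standard parabolic subgroup)).

For a pre-Coxeter system `s : B → W` with reflection cocycle `N` (any index type) and a reflection subgroup `G₁ = ⟨G₁ ∩ T⟩`:

* ★ **`χ` is transitive**: computed inside the reflection system `(G₁, χ(G₁))` (reflections `G₁ ∩ T`, cocycle `N ∩ G₁`), the canonical generators of a
  subgroup `G ≤ G₁` are those computed in `(W, S)` (`coe_image_canonicalGenerators_restrict`);
* ★★ **Proposition 3.5 (⟹): if `X′ ⊆ χ(G₁)` then `χ(⟨X′⟩) = X′`; in particular `χ(⟨t₁, t₂⟩) = {t₁, t₂}` for all `t₁, t₂ ∈ χ(G₁)`**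
  (`canonicalGenerators_closure_eq_of_subset`, `canonicalGenerators_closure_pair`);
* the same for a Mathlib Coxeter system of any rank with the left-inversion cocycle (`CoxeterSystem.canonicalGenerators_closure_eq_of_subset`).

PROVED theorems only (no definition, no named fact, no `sorry`: net debt 0); no instance, no notation.  NOT here: the converse (sufficiency) half of
Proposition 3.5 («`T′ = χ(⟨T′⟩)` if `χ(⟨t₁, t₂⟩) = {t₁, t₂}` for all `t₁, t₂ ∈ T′`»), whose printed proof is the induction (3.6).

## Source, verbatim

M. Dyer, *Reflection subgroups of Coxeter systems*, J. Algebra **135** (1990) 57–73 [Dyer1990] (fetched `paper:doi-10-1016-0021-8693-90-90149-i`, pp. 63–65):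
«**(2.11) Remark.** Let `(G, X)` be a reflection system, and `X′ ⊆ X`. Then `(⟨X′⟩, X′)` is a reflection system and its length function is the restriction
of `l` to `⟨X′⟩`. … **(3.1) Definition.** If `G_1` is a subgroup of `G`, we set `χ(G_1) = {t ∈ T | N(t) ∩ G_1 = {t}}`. Note that `χ(G_1) ⊆ G_1` and
`G_1 ∩ X = χ(G_1) ∩ X`. … **(3.3) Theorem** … (ii) `(G_1, X_1)` [`X_1 = χ(G_1)`] is a reflection system with `G_1 ∩ T = ⋃_{g ∈ G_1} gX_1g⁻¹` … and for `g ∈ G_1`,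
`N_1(g) = N(g) ∩ G_1`. … **(3.5) Proposition.** Let `T′ ⊆ T`. Then `T′ = χ(⟨T′⟩)` iff `χ(⟨t_1, t_2⟩) = {t_1, t_2}` for all `t_1, t_2 ∈ T′`. *Proof.* Suppose
`T′ = χ(⟨T′⟩)`; then from Definition 3.1 and Remark 2.11, `χ(⟨{t_1, t_2}⟩) = {t_1, t_2}` for any `t_1, t_2 ∈ T′`. …»
-/

namespace Literature.GroupTheory.Coxeter

namespace PreCoxeterSystem

variable {B W : Type*} [Group W] {s : B → W} {N : W → Set W} {G₁ : Subgroup W}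

/-- **The cocycle data of a subgroup `G ≤ G₁` seen in `W`: `N(t) ∩ G = (N ∩ G₁)(t) ∩ G` (as subsets of `W`).** [cite: Dyer1990, §3 Theorem 3.3 (ii)
(«`N_1(g) = N(g) ∩ G_1`»)] -/
theorem coe_image_restrict_inter (t : G₁) (G : Subgroup G₁) :
    Subtype.val '' (restrict N G₁ t ∩ (G : Set G₁)) = N t ∩ (G.map G₁.subtype : Set W) := by
  ext u
  simp only [Set.mem_image, Set.mem_inter_iff, mem_restrict_iff, SetLike.mem_coe, Subgroup.mem_map, Subgroup.coe_subtype]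
  constructor
  · rintro ⟨u', ⟨hu'N, hu'G⟩, rfl⟩
    exact ⟨hu'N, u', hu'G, rfl⟩
  · rintro ⟨huN, u', hu'G, rfl⟩
    exact ⟨u', ⟨huN, hu'G⟩, rfl⟩

/-- ★ **`χ` is transitive: for `G ≤ G₁`, the canonical generators of `G` computed in the reflection system `(G₁, χ(G₁))` are those computed in `(W, S)`.**
[cite: Dyer1990, §3 Theorem 3.3 (ii), Definition 3.1] -/
theorem coe_image_canonicalGenerators_restrict (h : IsPreCoxeterSystem s) (hN : IsReflectionCocycle s N)
    (hG₁ : Subgroup.closure ((G₁ : Set W) ∩ reflections s) = G₁) (G : Subgroup G₁) :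
    Subtype.val '' canonicalGenerators (inclusion s N G₁) (restrict N G₁) G = canonicalGenerators s N (G.map G₁.subtype) := by
  ext t
  simp only [Set.mem_image, mem_canonicalGenerators_iff]
  constructor
  · rintro ⟨t', ⟨ht'T, ht'N⟩, rfl⟩
    refine ⟨(mem_reflections_inclusion_iff h hN hG₁ t').1 ht'T, ?_⟩
    rw [← coe_image_restrict_inter, ht'N, Set.image_singleton]
  · rintro ⟨htT, htN⟩
    have htG : t ∈ (G.map G₁.subtype : Set W) := by
      have := canonicalGenerators_subset s N (G.map G₁.subtype) ⟨htT, htN⟩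
      exact this
    obtain ⟨t', ht'G, rfl⟩ := Subgroup.mem_map.1 htG
    refine ⟨t', ⟨(mem_reflections_inclusion_iff h hN hG₁ t').2 htT, ?_⟩, rfl⟩
    apply Set.image_val_injective
    rw [coe_image_restrict_inter, Set.image_singleton]
    exact htN

/-- ★★ **Proposition 3.5 (⟹) ∕ Remark 2.11 with (3.1): every subset `X′` of the canonical generators `χ(G₁)` of a reflection subgroup `G₁ = ⟨G₁ ∩ T⟩` is the
set of canonical generators of the subgroup it generates: `χ(⟨X′⟩) = X′`.** [cite: Dyer1990, §3 Proposition 3.5 (proof, first sentence), §2 Remark 2.11, §3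
Definition 3.1] -/
theorem canonicalGenerators_closure_eq_of_subset (h : IsPreCoxeterSystem s) (hN : IsReflectionCocycle s N)
    (hG₁ : Subgroup.closure ((G₁ : Set W) ∩ reflections s) = G₁) {X' : Set W} (hX' : X' ⊆ canonicalGenerators s N G₁) :
    canonicalGenerators s N (Subgroup.closure X') = X' := by
  -- `X′` as a set `I` of indices of the reflection system `(G₁, χ(G₁))`
  let I : Set (canonicalGenerators s N G₁) := {t | (t : W) ∈ X'}
  have h₁ := isPreCoxeterSystem_inclusion h hN hG₁ (s := s) (N := N) (G₁ := G₁)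
  have hN₁ := isReflectionCocycle_restrict hN (G₁ := G₁)
  -- `χ_{G₁}(⟨I⟩) = I` (standard parabolic of the reflection system `(G₁, χ(G₁))`)
  have hpar := hN₁.canonicalGenerators_closure_eq h₁ I
  -- transport to `W`
  have himage : Subtype.val '' (inclusion s N G₁ '' I) = X' := by
    ext t
    simp only [Set.mem_image]
    constructor
    · rintro ⟨u, ⟨t', ht', rfl⟩, rfl⟩; exact ht'
    · intro ht; exact ⟨⟨t, canonicalGenerators_subset s N G₁ (hX' ht)⟩, ⟨⟨t, hX' ht⟩, ht, rfl⟩, rfl⟩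
  have hmap : (Subgroup.closure (inclusion s N G₁ '' I)).map G₁.subtype = Subgroup.closure X' := by
    rw [MonoidHom.map_closure, Subgroup.coe_subtype, himage]
  rw [← hmap, ← coe_image_canonicalGenerators_restrict h hN hG₁, hpar, himage]

/-- ★★ **Proposition 3.5 (⟹) for pairs: `χ(⟨t₁, t₂⟩) = {t₁, t₂}` for any two canonical generators `t₁, t₂ ∈ χ(G₁)`.** [cite: Dyer1990, §3 Proposition 3.5] -/
theorem canonicalGenerators_closure_pair (h : IsPreCoxeterSystem s) (hN : IsReflectionCocycle s N)
    (hG₁ : Subgroup.closure ((G₁ : Set W) ∩ reflections s) = G₁) {t₁ t₂ : W} (ht₁ : t₁ ∈ canonicalGenerators s N G₁)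
    (ht₂ : t₂ ∈ canonicalGenerators s N G₁) : canonicalGenerators s N (Subgroup.closure {t₁, t₂}) = {t₁, t₂} :=
  canonicalGenerators_closure_eq_of_subset h hN hG₁ (by rintro t (rfl | rfl); exacts [ht₁, ht₂])

/-- **`χ(χ-generated subgroup)`: with `G₁ = W` — every subset `X′ ⊆ S` of the simple generators satisfies `χ(⟨X′⟩) = X′`** (the canonical generators of `W`
itself are `S`). [cite: Dyer1990, §3 Definition 3.1 («`G_1 ∩ X = χ(G_1) ∩ X`»), §2 Remark 2.11] -/
theorem canonicalGenerators_top (hN : IsReflectionCocycle s N) (h : IsPreCoxeterSystem s) :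
    canonicalGenerators s N (⊤ : Subgroup W) = Set.range s := by
  have := hN.canonicalGenerators_closure_eq h (Set.univ : Set B)
  rwa [Set.image_univ, h.closure_range] at this

end PreCoxeterSystem

/-! ## Mathlib Coxeter systems of any rank -/

section CoxeterSystem

open PreCoxeterSystem

variable {B W : Type*} [Group W] {M : CoxeterMatrix B} (cs : CoxeterSystem M W)

/-- ★★ **Proposition 3.5 (⟹) for a Coxeter group of any rank: if `W′` is generated by reflections and `X′ ⊆ χ(W′)` (canonical generators for the
left-inversion cocycle), then `χ(⟨X′⟩) = X′`.** [cite: Dyer1990, §3 Proposition 3.5] [cite: Humphreys1990, §8.2] -/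
theorem CoxeterSystem.canonicalGenerators_closure_eq_of_subset (W' : Subgroup W)
    (hW' : Subgroup.closure ((W' : Set W) ∩ {t | cs.IsReflection t}) = W') {X' : Set W}
    (hX' : X' ⊆ canonicalGenerators cs.simple (fun w => {t | cs.IsLeftInversion w t}) W') :
    canonicalGenerators cs.simple (fun w => {t | cs.IsLeftInversion w t}) (Subgroup.closure X') = X' := by
  have hW'' : Subgroup.closure ((W' : Set W) ∩ reflections cs.simple) = W' := by
    have e : reflections cs.simple = {t | cs.IsReflection t} := by
      ext t; exact ⟨fun ⟨w, i, ht⟩ => ⟨w, i, ht⟩, fun ⟨w, i, ht⟩ => ⟨w, i, ht⟩⟩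
    rw [e]; exact hW'
  exact PreCoxeterSystem.canonicalGenerators_closure_eq_of_subset (isPreCoxeterSystem_simple cs) (isReflectionCocycle_isLeftInversion cs) hW'' hX'

/-- **The canonical generators of the whole Coxeter group are its simple reflections.** [cite: Dyer1990, §3 Definition 3.1] -/
theorem CoxeterSystem.canonicalGenerators_top :
    canonicalGenerators cs.simple (fun w => {t | cs.IsLeftInversion w t}) (⊤ : Subgroup W) = Set.range cs.simple :=
  PreCoxeterSystem.canonicalGenerators_top (isReflectionCocycle_isLeftInversion cs) (isPreCoxeterSystem_simple cs)

end CoxeterSystem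

end Literature.GroupTheory.Coxeter
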